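import Summits.CriticalPhenomena.PercolationContinuityZ3.Theorems.Transplant.FKConnectivityAllQTwoSumClass
import Summits.CriticalPhenomena.PercolationContinuityZ3.Theorems.Transplant.FKConnectivityAllQOneSum
import Summits.CriticalPhenomena.PercolationContinuityZ3.Theorems.Transplant.FKThreeApexAllPairsEmbedded
import Summits.CriticalPhenomena.PercolationContinuityZ3.Theorems.Transplant.FKConnectivityAllQPrism
import Summits.CriticalPhenomena.PercolationContinuityZ3.Theorems.Transplant.FKConnectivityAllQK5Supp
import HarnessLib

/-!
# Connectivity correlation inequalities for `φ_{w,q}`, every `q > 0` — THE POTTS–RAYLEIGH STOCK OF THE `q < 1` PROGRAMME: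
# 2-trees, `≤ 5`-vertex graphs, wheels, vertex-cover-`≤ 3` graphs and prisms, glued along cut vertices and shared pairs
# (hence — by Dirac–Lovász — every graph with no two vertex-disjoint cycles)

Support file (`--supports stmt-CriticalPhenomena-4575`), FK sub-lane `prim-bschramm-fk-3` (gen 19) of the post-continuity programme;
builds on p205010 (kernel theorem, internal audit signed; external expert review pending).  One definition (the inductive class
`FK.IsPRStock`), no named facts, no sorries; standard axioms.

THE CLASS.  `FK.IsPRStock E` is the least class of edge sets `E ⊆ Sym2 V` (finite vertex type `V`) containing
  (1) the 2-trees (`FK.IsTwoTree`; their subsets are the series–parallel graphs) — fk-1 g5;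
  (2) every pair set spanned by at most five vertices (`K₅` and its subgraphs: `K₄`, `K₅⁻`, `W₄`, …) — fk-3 g10–g11;
  (3) the wheels `W_n`, `n ≥ 3` rim vertices — fk-3 g8;
  (4) the three-apex patterns `K_{1,1,1,n}` (every graph with a vertex cover of size `≤ 3`: `K_{3,n}`, `K₆ − K₃`, …) — fk-3 g12–g18;
  (5) the triangular prisms `K₃ □ K₂` (planar dual of `K₅⁻`) — fk-3 g19;
and closed under (6) 1-sums at a cut vertex and (7) parallel connection along a shared pair (Wagner's 2-sum; fk-1 g6, fk-3 g8).
**`FK.edgeNegCorrSupp_of_isPRStock`** (`0 < q ≤ 1`): every member carries edge-negatively associated random-cluster measures `φ_{w,q}`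
for ALL weight vectors supported in it — `φ(J_e ∩ J_f) ≤ φ(J_e) φ(J_f)` (Grimmett 2006 (3.94), conjectured for all graphs when `q < 1`,
open) — and so does every subset of a member (`…_of_subset_prStock`); for `q < 1` the hub inequality of Ayyer–Linusson–Ravichandran
(13) and pairwise positive correlation of connections follow (`hubUnder_of_isPRStock`, `pairConnPosUnder_of_isPRStock`).  The proof is
a one-line induction assembling the kernel theorems of the sub-lanes; `IsTwoTreeK4Glued ⊆ IsPRStock` (`IsTwoTreeK4Glued.isPRStock`).
Further closure operations are tree lemmas applying to members: planar/abstract duality (`FK.Dual.edgeNegCorrSupp_of_dual`) and contraction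
of a pair (`FK.Contract.edgeNegCorrSupp_contract`, sibling file) — with deletion (`EdgeNegCorrSupp.mono`) and 2-sums these are all the closure
operations of Wagner's Thm. 5.8.
THE STRUCTURAL COROLLARY (informal; the graph theory is NOT formalised here).  By Dirac's theorem (Bollobás 1978, Ch. III Thm. 2.1:
the 3-connected graphs without two vertex-disjoint cycles are `W_k`, `K₅`, `K₅⁻`, `K(3,p)+{0,…,3 edges in the 3-class}`) and Lovász's
theorem (ibid. Thm. 2.2: a multigraph with `δ ≥ 3` and no two disjoint cycles either has a vertex meeting all cycles — tree-width `≤ 2`,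
a partial 2-tree — or is a fat triangle, a `K₄` with a fat triangle, `K₅`, a fat `K₅⁻`, a wheel with fat spokes, or `K(3,p)` plus
(fat) edges in the 3-class), every finite simple graph WITHOUT TWO VERTEX-DISJOINT CYCLES is obtained from a subgraph of (1)–(4) by
subdividing edges, fattening edges into internally disjoint paths and attaching pendant trees — each a subset of a parallel connection
with a cycle or a triangle (2-trees) — and is therefore a subset of a member of `IsPRStock`: **every finite graph with no two
vertex-disjoint cycles is Potts–Rayleigh for all `0 < q ≤ 1`**.  The prism (5) is the first member beyond that class.
[cite: Grimmett2006, §3.9 eq. (3.94), Conj. (3.96) (pp. 63–64)] [cite: Wagner2006, Thm. 5.8, §5.3, Conj. 5.3 (pp. 13–15)]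
[cite: Bollobas1978, Ch. III §2 Thms. 2.1–2.2] [cite: AyyerLinussonRavichandran2025, §7 eq. (13), Conj. 7.1 (pp. 22–23)]
-/

noncomputable section

namespace Summit.CriticalPhenomena.PercolationContinuityZ3.Theorems

namespace FK

open MeasureTheory Literature.Probability.LatticeModels Literature.Probability.Percolation
open scoped Classical

variable {V : Type*}

/-- **The Potts–Rayleigh stock** of the `q < 1` programme: the least class of edge sets containing the 2-trees, the pair sets spanned
by at most five vertices, the wheels, the three-apex patterns `K_{1,1,1,n}` and the prisms `K₃ □ K₂`, and closed under 1-sums at a cut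
vertex and parallel connection along a shared pair.  Every member is Potts–Rayleigh on `(0,1]` (`edgeNegCorrSupp_of_isPRStock`);
informally (Dirac–Lovász, Bollobás 1978 III.2.1–2.2) its subsets include every finite graph with no two vertex-disjoint cycles.
[cite: Wagner2006, Thm. 5.8, §5.3 (pp. 14–15)] [cite: Bollobas1978, Ch. III §2 Thms. 2.1–2.2] -/
inductive IsPRStock [Fintype V] : Set (Sym2 V) → Prop
  /-- (1) every 2-tree is in the class -/
  | twoTree {T : Set (Sym2 V)} (hT : IsTwoTree T) : IsPRStock T
  /-- (2) every pair set spanned by at most five vertices is in the class -/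
  | fiveVerts {E : Set (Sym2 V)} (A : Finset V) (hA : A.card ≤ 5) (hE : ∀ e ∈ E, ∀ v ∈ e, v ∈ A) : IsPRStock E
  /-- (3) every wheel with `n ≥ 3` distinct rim vertices `u 0, …, u (n-1)` and hub `h` is in the class -/
  | wheel (h : V) (u : ℕ → V) {n : ℕ} (hn : 3 ≤ n) (hinj : ∀ j k, j < n → k < n → u j = u k → j = k)
      (hux : ∀ j, j < n → u j ≠ h) : IsPRStock ↑(Wheel.wheelPairs h u n)
  /-- (4) every three-apex pattern (apices `a, b, c`, leaves `u 0, …, u (n-1)`) is in the class -/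
  | threeApex (a b c : V) (u : ℕ → V) {n : ℕ} (hab : a ≠ b) (hac : a ≠ c) (hbc : b ≠ c)
      (hinj : ∀ j k, j < n → k < n → u j = u k → j = k) (hua : ∀ j, j < n → u j ≠ a) (hub : ∀ j, j < n → u j ≠ b)
      (huc : ∀ j, j < n → u j ≠ c) : IsPRStock ↑(ThreeApex.fullPairs a b c u n)
  /-- (5) every prism `K₃ □ K₂` (image of the listed prism along an injection of `Fin 6`) is in the class -/
  | prism (j : Fin 6 ↪ V) : IsPRStock (Sym2.map j '' Set.range prismD.edge)
  /-- (6) 1-sum: two members whose vertex sets share at most the vertex `m` -/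
  | oneSum {E₁ E₂ : Set (Sym2 V)} {V₁ V₂ : Set V} {m : V} (h₁ : IsPRStock E₁) (h₂ : IsPRStock E₂) (hd : Disjoint E₁ E₂)
      (hV₁ : ∀ e ∈ E₁, ∀ z ∈ e, z ∈ V₁) (hV₂ : ∀ e ∈ E₂, ∀ z ∈ e, z ∈ V₂) (hS : V₁ ∩ V₂ ⊆ {m}) : IsPRStock (E₁ ∪ E₂)
  /-- (7) parallel connection along the shared pair `st` -/
  | glue {E₁ E₂ : Set (Sym2 V)} {s t : V} (h₁ : IsPRStock E₁) (h₂ : IsPRStock E₂) (hst : s ≠ t)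
      (hst₁ : s(s, t) ∈ E₁) (hst₂ : s(s, t) ∈ E₂) (hd : Disjoint (E₁ \ {s(s, t)}) E₂)
      (hV : ∀ z : V, (∃ e ∈ E₁, z ∈ e) → (∃ e ∈ E₂, z ∈ e) → z = s ∨ z = t) : IsPRStock (E₁ ∪ E₂)

variable [Fintype V]

/-- **Pair sets spanned by at most five vertices are Potts–Rayleigh on `(0,1]`** (support form of fk-3 g11's `K₅` theorem
`edgeNegCorrOn_of_card_le_five`, moved to any finite vertex type along the subtype embedding).
[cite: Grimmett2006, §3.9 eq. (3.94) (pp. 63–64)] [cite: Wagner2006, Ex. 5.1, Conj. 5.3 (p. 13)] -/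
theorem edgeNegCorrSupp_of_verts_card_le_five {q : ℝ} (hq0 : 0 < q) (hq1 : q ≤ 1) {E : Set (Sym2 V)} (A : Finset V)
    (hA : A.card ≤ 5) (hE : ∀ e ∈ E, ∀ v ∈ e, v ∈ A) : EdgeNegCorrSupp E q := by
  set j : {v // v ∈ A} ↪ V := Function.Embedding.subtype (· ∈ A) with hj
  have hcard : Fintype.card {v // v ∈ A} ≤ 5 := by rw [Fintype.card_coe]; exact hA
  have huniv : EdgeNegCorrSupp (Sym2.map j '' (Set.univ : Set (Sym2 {v // v ∈ A}))) q :=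
    (edgeNegCorrSupp_univ_of_edgeNegCorrOn (edgeNegCorrOn_of_card_le_five hcard hq0 hq1)).image j hq0
  refine EdgeNegCorrSupp.mono (fun e he => ?_) huniv
  rw [Set.image_univ]
  exact mem_range_sym2Map_subtype A e (hE e he)

/-- **Every member of the Potts–Rayleigh stock is Potts–Rayleigh on `(0,1]`**: for `E ∈ IsPRStock` and every weight vector `w`
supported in `E`, `φ_{w,q}(J_e ∩ J_f) ≤ φ_{w,q}(J_e)·φ_{w,q}(J_f)` for all non-loop `e` and all `f ≠ e` (`0 < q ≤ 1`).  Induction over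
the class: 2-trees (fk-1 g5), `≤ 5` vertices (fk-3 g11), wheels (fk-3 g8), three-apex patterns (fk-3 g18), prisms (fk-3 g19, planar
duality), 1-sums (fk-3 g8) and parallel connections (fk-1 g6, Wagner's 2-sum theorem) — all kernel theorems with standard axioms.
[cite: Grimmett2006, §3.9 eq. (3.94), Conj. (3.96) (pp. 63–64)] [cite: Wagner2006, Thm. 5.8, §5.3, Conj. 5.3 (pp. 13–15)] -/
theorem edgeNegCorrSupp_of_isPRStock {q : ℝ} (hq0 : 0 < q) (hq1 : q ≤ 1) {E : Set (Sym2 V)} (h : IsPRStock E) :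
    EdgeNegCorrSupp E q := by
  induction h with
  | twoTree hT => exact edgeNegCorrSupp_of_isTwoTree hq0 hq1 hT
  | fiveVerts A hA hE => exact edgeNegCorrSupp_of_verts_card_le_five hq0 hq1 A hA hE
  | wheel h u hn hinj hux => exact Wheel.edgeNegCorrSupp_wheelPairs hq0 hq1 h u hn hinj hux
  | threeApex a b c u hab hac hbc hinj hua hub huc =>
    exact ThreeApex.edgeNegCorrSupp_threeApexPairs hq0 hq1 a b c u hab hac hbc hinj hua hub huc
  | prism j => exact Prism.edgeNegCorrSupp_prism_map j hq0 hq1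
  | oneSum _ _ hd hV₁ hV₂ hS ih₁ ih₂ => exact EdgeNegCorrSupp.oneSum hq0 hd hV₁ hV₂ hS ih₁ ih₂
  | @glue E₁ E₂ s t _ _ hst hst₁ hst₂ hd hV ih₁ ih₂ =>
    exact edgeNegCorrSupp_parallelConnection hq0 hq1 hst hst₁ hst₂ hd (V₁ := {z | ∃ e ∈ E₁, z ∈ e})
      (V₂ := {z | ∃ e ∈ E₂, z ∈ e}) (fun e he z hz => ⟨e, he, hz⟩) (fun e he z hz => ⟨e, he, hz⟩)
      (fun z hz => by
        rcases hV z hz.1 hz.2 with rfl | rfl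
        · exact Or.inl rfl
        · exact Or.inr rfl)
      ih₁ ih₂

/-- Subsets of members of the stock are Potts–Rayleigh on `(0,1]` (weight `0` = deleted pair).
[cite: Grimmett2006, §3.9 eq. (3.94) (pp. 63–64)] [cite: Wagner2006, Thm. 5.8, §5.3 (pp. 14–15)] -/
theorem edgeNegCorrSupp_of_subset_prStock {q : ℝ} (hq0 : 0 < q) (hq1 : q ≤ 1) {S E : Set (Sym2 V)} (h : IsPRStock E)
    (hSE : S ⊆ E) : EdgeNegCorrSupp S q :=
  EdgeNegCorrSupp.mono hSE (edgeNegCorrSupp_of_isPRStock hq0 hq1 h)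

/-- Wagner's stock (2-trees and `K₄`'s glued along shared pairs, fk-1 g6's `IsTwoTreeK4Glued`) lies inside the Potts–Rayleigh stock.
[cite: Wagner2006, Thm. 5.8(d), §5.3 (pp. 14–15)] -/
theorem IsTwoTreeK4Glued.isPRStock {E : Set (Sym2 V)} (h : IsTwoTreeK4Glued E) : IsPRStock E := by
  induction h with
  | twoTree hT => exact IsPRStock.twoTree hT
  | @k4 x y z t _ _ _ _ _ _ =>
    refine IsPRStock.fiveVerts ({x, y, z, t} : Finset V) (Finset.card_le_four.trans (by norm_num)) ?_
    intro e he v hv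
    simp only [Set.mem_insert_iff, Set.mem_singleton_iff] at he
    rcases he with rfl | rfl | rfl | rfl | rfl | rfl <;>
      (rw [Sym2.mem_iff] at hv; rcases hv with rfl | rfl <;> simp)
  | glue _ _ hst hst₁ hst₂ hd hV ih₁ ih₂ => exact IsPRStock.glue ih₁ ih₂ hst hst₁ hst₂ hd hV

/-- **The hub inequality (Ayyer–Linusson–Ravichandran (13)) on the stock, every `q ∈ (0,1)`** — UNCONDITIONAL: for `w` supported in
`E ∈ IsPRStock` with `oa, ba ∈ E`, `φ_{w,q}(o ↔ a)·φ_{w,q}(b ↔ a) ≤ φ_{w,q}(o ↔ a ↔ b)`.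
[cite: AyyerLinussonRavichandran2025, §7 eq. (13), Conj. 7.1 (pp. 22–23)] [cite: Wagner2006, Conj. 5.3, §5.3 (pp. 13–15)] -/
theorem hubUnder_of_isPRStock {q : ℝ} (hq0 : 0 < q) (hq1 : q < 1) {E : Set (Sym2 V)} (h : IsPRStock E) {o a b : V}
    (hoa : s(o, a) ∈ E) (hba : s(b, a) ∈ E) (w : Sym2 V → unitInterval) (hw : ∀ e, ((w e : unitInterval) : ℝ) ≠ 0 → e ∈ E) :
    HubUnder (rcMeasureW w q ∅) o a b :=
  hubUnder_of_edgeNegCorr_on hq0 hq1 E (edgeNegCorrSupp_of_isPRStock hq0 hq1.le h) o a b hoa hba w hw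

/-- **Pairwise positive correlation of connection events on the stock, every `q ∈ (0,1)`** — UNCONDITIONAL: for `w` supported in
`E ∈ IsPRStock` and `xy, uv ∈ E`, `φ_{w,q}(x ↔ y)·φ_{w,q}(u ↔ v) ≤ φ_{w,q}(x ↔ y, u ↔ v)`.
[cite: AyyerLinussonRavichandran2025, §7 eq. (13)–(15), (19) (pp. 22–27)] [cite: Wagner2006, Conj. 5.3, §5.3 (pp. 13–15)] -/
theorem pairConnPosUnder_of_isPRStock {q : ℝ} (hq0 : 0 < q) (hq1 : q < 1) {E : Set (Sym2 V)} (h : IsPRStock E) {x y u v : V}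
    (hxy : s(x, y) ∈ E) (huv : s(u, v) ∈ E) (w : Sym2 V → unitInterval) (hw : ∀ e, ((w e : unitInterval) : ℝ) ≠ 0 → e ∈ E) :
    PairConnPosUnder (rcMeasureW w q ∅) x y u v :=
  pairConnPosUnder_of_edgeNegCorr_on hq0 hq1 E (edgeNegCorrSupp_of_isPRStock hq0 hq1.le h) x y u v hxy huv w hw

end FK

end Summit.CriticalPhenomena.PercolationContinuityZ3.Theorems

end
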